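import Literature.AlgebraicGeometry.Resolution.CoordinateBlowupTower
import Literature.AlgebraicGeometry.Resolution.CoordinateBlowupStrictTransformIdeal
import HarnessLib

/-!
# Strict transform ideals along a tower of coordinate blow-ups

Topic: `Literature/AlgebraicGeometry/Resolution`. Joins `CoordinateBlowupTower.lean` (a standard
chart of a tower of coordinate blow-ups of `𝔸^σ_S` = a word `w` of steps `(A_t, i_t ∈ A_t)`;
total transform `towerSubst`, iterated proper transform `towerProperTransform`, Y. Hu,
arXiv:2507.21400, §5.1 Def. 5.4 and (5.8)) with `CoordinateBlowupStrictTransformIdeal.lean` (one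
step: the strict transform ideal `I^st` = `X_{i₀}`-saturation of the total transform; the
criterion for "the proper transforms of the generators define the strict transform").

For an ideal `I ⊆ S[X_σ]` (a closed subscheme `Z = V(I)` of the bottom chart) and a word `w`, the
ideal of the ITERATED strict transform of `Z` on the chart `𝔙_w` is

  `towerStrictTransformIdeal S w I` — apply `coordStrictTransformIdeal` step by step.

PROVED:
* `towerSubst_mem_towerStrictTransformIdeal`, `towerProperTransform_mem_towerStrictTransformIdeal`,
  `span_image_towerProperTransform_le` — **the robust containment**: for every `f ∈ I` the
  iterated proper transform `f_𝔙` lies in the iterated strict transform ideal, i.e.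
  `Z̃ ∩ 𝔙_w ⊆ V(f_𝔙 : f ∈ G)` for any `G ⊆ I` (this, not "defined by", is what Hu's Prop. 5.16,
  6.11, Lemma 7.4–7.5 give unconditionally, and all that Thm. 8.5's dimension squeeze uses);
* `towerStrictTransformIdeal_top`, `towerStrictTransformIdeal_mono`;
* `towerStrictTransformIdeal_isPrime_or_eq_top` — **the iterated strict transform of an integral
  closed subscheme is integral or empty** (`I` prime ⇒ prime or `⊤` at every level);
* `TowerRegularGens S w G` — the stepwise regularity hypothesis (at each step the exceptional
  variable is a non-zero-divisor modulo the proper transforms of the current generators), and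
  `towerStrictTransformIdeal_span_eq` — **under it the iterated proper transforms of the
  generators DEFINE the iterated strict transform**: `(G)^st_w = (f_𝔙 : f ∈ G)`.

No named facts (D-0026).

## References

* Y. Hu, *Universal Characteristic-free Resolution of Singularities, I*, arXiv:2507.21400 (2025),
  §5.1 Def. 5.4, Prop. 5.16 (1), Prop. 6.11 (1), Lemma 7.4 (1). [Hu2025]
* U. Görtz, T. Wedhorn, *Algebraic Geometry I*, 2nd ed. (2020), Prop. 13.96 (2), p. 416. [GortzWedhorn2020]
-/

noncomputable section

open MvPolynomial

namespace Literature.AlgebraicGeometry.Resolution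

universe u v

variable (S : Type u) [CommRing S] {σ : Type v}

/-- **The iterated strict transform ideal** along the word `w` (head = first blow-up).
[cite: GortzWedhorn2020, Prop. 13.96 (2) and p. 416] -/
def towerStrictTransformIdeal : List (CoordBlowupStep σ) → Ideal (MvPolynomial σ S) → Ideal (MvPolynomial σ S)
  | [] => id
  | st :: w => fun I => towerStrictTransformIdeal w (coordStrictTransformIdeal S st.A st.i₀ I)

/-- The empty word: no blow-up. [folklore] -/
@[simp] theorem towerStrictTransformIdeal_nil (I : Ideal (MvPolynomial σ S)) :
    towerStrictTransformIdeal S ([] : List (CoordBlowupStep σ)) I = I := rfl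

/-- Unfolding along `st :: w`. [folklore] -/
@[simp] theorem towerStrictTransformIdeal_cons (st : CoordBlowupStep σ) (w : List (CoordBlowupStep σ))
    (I : Ideal (MvPolynomial σ S)) :
    towerStrictTransformIdeal S (st :: w) I =
      towerStrictTransformIdeal S w (coordStrictTransformIdeal S st.A st.i₀ I) := rfl

/-- Monotonicity in `I`. [folklore] -/
theorem towerStrictTransformIdeal_mono (w : List (CoordBlowupStep σ)) {I J : Ideal (MvPolynomial σ S)}
    (h : I ≤ J) : towerStrictTransformIdeal S w I ≤ towerStrictTransformIdeal S w J := by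
  induction w generalizing I J with
  | nil => exact h
  | cons st w ih => exact ih (coordStrictTransformIdeal_mono S st.A st.i₀ h)

/-- The strict transform of the whole space is the whole chart: `⊤^st = ⊤`. [folklore] -/
theorem coordStrictTransformIdeal_top (A : Set σ) (i₀ : σ) :
    coordStrictTransformIdeal S A i₀ (⊤ : Ideal (MvPolynomial σ S)) = ⊤ := by
  rw [Ideal.eq_top_iff_one]
  have h := coordBlowupSubst_mem S A i₀ (I := (⊤ : Ideal (MvPolynomial σ S))) (f := 1) Submodule.mem_top
  rwa [map_one] at h

/-- Along a tower: `⊤^st_w = ⊤`. [folklore] -/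
theorem towerStrictTransformIdeal_top (w : List (CoordBlowupStep σ)) :
    towerStrictTransformIdeal S w (⊤ : Ideal (MvPolynomial σ S)) = ⊤ := by
  induction w with
  | nil => rfl
  | cons st w ih => rw [towerStrictTransformIdeal_cons, coordStrictTransformIdeal_top, ih]

/-! ### The robust containment: transforms of members of `I` lie in the iterated strict transform ideal -/

/-- `π*_w f ∈ I^st_w` for `f ∈ I`. [folklore] -/
theorem towerSubst_mem_towerStrictTransformIdeal (w : List (CoordBlowupStep σ))
    {I : Ideal (MvPolynomial σ S)} {f : MvPolynomial σ S} (hf : f ∈ I) :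
    towerSubst S w f ∈ towerStrictTransformIdeal S w I := by
  induction w generalizing I f with
  | nil => exact hf
  | cons st w ih => exact ih (coordBlowupSubst_mem S st.A st.i₀ hf)

/-- **`f_𝔙 ∈ I^st_w` for every `f ∈ I`**: the iterated proper transform of a defining equation of
`Z` vanishes on the iterated strict transform `Z̃ ∩ 𝔙_w` — the CONTAINMENT
`Z̃ ∩ 𝔙_w ⊆ V(f_𝔙)` that holds unconditionally (Hu Prop. 5.16 (1), 6.11 (1), Lemma 7.4 (1) claim
the stronger "defined by"). [cite: Hu2025, §5 Prop. 5.16 (1)] -/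
theorem towerProperTransform_mem_towerStrictTransformIdeal (w : List (CoordBlowupStep σ))
    {I : Ideal (MvPolynomial σ S)} {f : MvPolynomial σ S} (hf : f ∈ I) :
    towerProperTransform S w f ∈ towerStrictTransformIdeal S w I := by
  induction w generalizing I f with
  | nil => exact hf
  | cons st w ih => exact ih (coordProperTransform_mem S st.A st.i₀ st.mem hf)

/-- For `G ⊆ I`: `(f_𝔙 : f ∈ G) ⊆ I^st_w`. [cite: Hu2025, §5 Prop. 5.16 (1)] -/
theorem span_image_towerProperTransform_le (w : List (CoordBlowupStep σ))
    {I : Ideal (MvPolynomial σ S)} {G : Set (MvPolynomial σ S)} (hG : G ⊆ I) :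
    Ideal.span (towerProperTransform S w '' G) ≤ towerStrictTransformIdeal S w I := by
  rw [Ideal.span_le]
  rintro _ ⟨f, hf, rfl⟩
  exact towerProperTransform_mem_towerStrictTransformIdeal S w (hG hf)

/-! ### Integral subschemes have integral (or empty) iterated strict transforms -/

/-- **For `I` prime, `I^st_w` is prime or `⊤`**: the iterated strict transform of an integral
closed subscheme is integral, or empty on this chart.
[cite: GortzWedhorn2020, Prop. 13.96 (2) and p. 416] -/
theorem towerStrictTransformIdeal_isPrime_or_eq_top (w : List (CoordBlowupStep σ))
    (I : Ideal (MvPolynomial σ S)) [I.IsPrime] :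
    (towerStrictTransformIdeal S w I).IsPrime ∨ towerStrictTransformIdeal S w I = ⊤ := by
  induction w generalizing I with
  | nil => exact Or.inl ‹I.IsPrime›
  | cons st w ih =>
    rw [towerStrictTransformIdeal_cons]
    rcases coordStrictTransformIdeal_isPrime_or_eq_top S st.A st.i₀ (I := I) with h | h
    · haveI := h
      exact ih _
    · rw [h, towerStrictTransformIdeal_top]
      exact Or.inr rfl

/-! ### When the iterated proper transforms of the generators define the iterated strict transform -/

/-- **Stepwise regularity of the exceptional variables modulo the current proper transforms**:
along `st :: w`, the variable `X_{st.i₀}` is a non-zero-divisor modulo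
`(f_𝔙 : f ∈ G)` (one step), and recursively for the transformed generators along `w`.
[cite: GortzWedhorn2020, Prop. 13.96 (2) and p. 416] -/
def TowerRegularGens : List (CoordBlowupStep σ) → Set (MvPolynomial σ S) → Prop
  | [] => fun _ => True
  | st :: w => fun G =>
    (∀ g : MvPolynomial σ S, X st.i₀ * g ∈ Ideal.span (coordProperTransform S st.A st.i₀ '' G) →
        g ∈ Ideal.span (coordProperTransform S st.A st.i₀ '' G)) ∧
      TowerRegularGens w (coordProperTransform S st.A st.i₀ '' G)

/-- The empty word imposes nothing. [folklore] -/
@[simp] theorem towerRegularGens_nil (G : Set (MvPolynomial σ S)) :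
    TowerRegularGens S ([] : List (CoordBlowupStep σ)) G := trivial

/-- Unfolding along `st :: w`. [folklore] -/
theorem towerRegularGens_cons_iff (st : CoordBlowupStep σ) (w : List (CoordBlowupStep σ))
    (G : Set (MvPolynomial σ S)) :
    TowerRegularGens S (st :: w) G ↔
      (∀ g : MvPolynomial σ S, X st.i₀ * g ∈ Ideal.span (coordProperTransform S st.A st.i₀ '' G) →
          g ∈ Ideal.span (coordProperTransform S st.A st.i₀ '' G)) ∧
        TowerRegularGens S w (coordProperTransform S st.A st.i₀ '' G) :=
  Iff.rfl

/-- Iterated proper transforms of a set, as an iterated image. [folklore] -/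
theorem image_towerProperTransform_cons (st : CoordBlowupStep σ) (w : List (CoordBlowupStep σ))
    (G : Set (MvPolynomial σ S)) :
    towerProperTransform S (st :: w) '' G =
      towerProperTransform S w '' (coordProperTransform S st.A st.i₀ '' G) := by
  rw [Set.image_image]
  rfl

/-- **Under stepwise regularity the iterated proper transforms of the generators generate the
iterated strict transform ideal**: `(G)^st_w = (f_𝔙 : f ∈ G)` — the precise form in which "the
proper transform `Ṽ ∩ 𝔙` is defined by the proper transforms of its defining equations"
(Hu Prop. 5.16 (1) etc.) is valid. [cite: Hu2025, §5 Prop. 5.16 (1)]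
[cite: GortzWedhorn2020, Prop. 13.96 (2) and p. 416] -/
theorem towerStrictTransformIdeal_span_eq (w : List (CoordBlowupStep σ)) (G : Set (MvPolynomial σ S))
    (hreg : TowerRegularGens S w G) :
    towerStrictTransformIdeal S w (Ideal.span G) = Ideal.span (towerProperTransform S w '' G) := by
  induction w generalizing G with
  | nil =>
    show Ideal.span G = Ideal.span (id '' G)
    rw [Set.image_id]
  | cons st w ih =>
    obtain ⟨h1, h2⟩ := (towerRegularGens_cons_iff S st w G).mp hreg
    rw [towerStrictTransformIdeal_cons,
      coordStrictTransformIdeal_span_eq_of_forall_mem S st.A st.i₀ st.mem G h1, ih _ h2,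
      image_towerProperTransform_cons]

end Literature.AlgebraicGeometry.Resolution

end
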